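import Summits.AnomalousDissipation.AnomalousDissipation.Theorems.DegreeGateQuietFluctuationFloorRung
import Literature.Analysis.FluidPDE.StatisticalSolutionEnergyEq
import Literature.Analysis.FluidPDE.StatisticalSolutionDirac
import Literature.Analysis.FunctionSpaces.TorusReflectionCalculus
import Literature.Analysis.FunctionSpaces.TorusHolderSobolevEmbedding
import Literature.Analysis.FunctionSpaces.TorusAxisAverage
import Literature.Analysis.FunctionSpaces.TorusSobolevNorm
import Literature.Analysis.FunctionSpaces.TorusSobolevNormProofs
import Literature.Analysis.FunctionSpaces.TorusTrigPoly
import Literature.Analysis.FunctionSpaces.TorusVectorParseval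
import Literature.Analysis.FunctionSpaces.TorusSpectralWeakDerivative
import HarnessLib

/-!
# DegreeGate — front readout HEADS: part 1 of 3 (§1 Fourier coefficients and Taylor–Green symmetries, §2 parity bookkeeping)

Part 1 of the lens-5 g65 kernel `DegreeGateFrontHeadRungs` (see the TREE LANDING NOTE in `DegreeGateFrontHeadRungs.lean`). Namespace
`…Theorems.DegreeGate`; declarations byte-identical to the landable. [cite: doi:10.1017/s0022112083001159, §2] [folklore]
-/

noncomputable section

set_option linter.dupNamespace false
set_option linter.style.longLine false

open MeasureTheory Filter UnitAddTorus
open scoped InnerProductSpace ComplexConjugate ENNReal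
open Literature.Analysis Literature.Analysis.FunctionSpaces Literature.Analysis.FunctionSpaces.Torus
open Summit.AnomalousDissipation.AnomalousDissipation.Theorems.TaylorGreenLoudGalerkinStates
open Summit.AnomalousDissipation.AnomalousDissipation.Theorems.TaylorGreenLoudGalerkinStates.Negative

namespace Summit.AnomalousDissipation.AnomalousDissipation.Theorems.DegreeGate

/-- The `L²(T³; ℝ³)` classes (local shorthand, not a definition). -/
local notation "𝐋" => MeasureTheory.Lp (EuclideanSpace ℝ (Fin 3)) 2 (MeasureTheory.volume : MeasureTheory.Measure (UnitAddTorus (Fin 3)))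

/-! ### §1 Fourier coefficients of an `L²` class and the Taylor–Green symmetries -/

/-- The Fourier coefficients `Û(k) ∈ ℂ³` of an `L²(T³; ℝ³)` class. [folklore] -/
def fc (U : 𝐋) (k : Fin 3 → ℤ) : EuclideanSpace ℂ (Fin 3) :=
  mFourierCoeff (EuclideanSpace.complexify ∘ (U : UnitAddTorus (Fin 3) → EuclideanSpace ℝ (Fin 3))) k

/-- An `L²` class on the (probability) torus is integrable. [folklore] -/
theorem integrable_coeFn (U : 𝐋) : Integrable (U : UnitAddTorus (Fin 3) → EuclideanSpace ℝ (Fin 3)) volume :=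
  (Lp.memLp U).integrable one_le_two

/-- Components: `Û(k)_j = 𝓕(x ↦ U(x)_j)(k)`. [folklore] -/
theorem fc_apply (U : 𝐋) (k : Fin 3 → ℤ) (j : Fin 3) :
    fc U k j = mFourierCoeff (fun x => ((U : UnitAddTorus (Fin 3) → EuclideanSpace ℝ (Fin 3)) x j : ℂ)) k :=
  mFourierCoeff_complexify_apply (integrable_coeFn U) k j

/-- Mean zero: `Û(0) = 0` for `U ∈ H`. [folklore] -/
theorem fc_zero {U : 𝐋} (hU : U ∈ energySpace (Fin 3)) : fc U 0 = 0 :=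
  Literature.Analysis.FluidPDE.Torus.mFourierCoeff_complexify_coe_zero_of_mem hU

/-- Reality: `Û(−k)_j = conj Û(k)_j`. [folklore] -/
theorem fc_neg_apply (U : 𝐋) (k : Fin 3 → ℤ) (j : Fin 3) : fc U (-k) j = conj (fc U k j) :=
  mFourierCoeff_complexify_neg_apply (integrable_coeFn U) k j

/-- Weak incompressibility on the Fourier side: `k · Û(k) = 0` for `U ∈ H`. [folklore] -/
theorem sum_mul_fc {U : 𝐋} (hU : U ∈ energySpace (Fin 3)) (k : Fin 3 → ℤ) :
    ∑ j, (k j : ℂ) * fc U k j = 0 :=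
  (Literature.Analysis.FluidPDE.Torus.isWeaklyDivFree_of_mem_energySpace hU).sum_mul_mFourierCoeff_eq_zero
    (Lp.memLp U) k

/-- `e_n(½) = (−1)^n`. [folklore] -/
theorem fourier_half (n : ℤ) : (fourier n (((1/2 : ℝ)) : UnitAddCircle) : ℂ) = (-1 : ℂ) ^ n := by
  rw [fourier_coe_apply, ← Complex.exp_pi_mul_I, ← Complex.exp_int_mul]
  congr 1
  push_cast
  ring

/-- `e_k(½ e_i) = (−1)^{k_i}` on `T³`. [folklore] -/
theorem mFourier_single_half (k : Fin 3 → ℤ) (i : Fin 3) :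
    mFourier k (Pi.single i (((1/2 : ℝ)) : UnitAddCircle) : UnitAddTorus (Fin 3)) = (-1 : ℂ) ^ (k i) := by
  simp only [mFourier, ContinuousMap.coe_mk]
  rw [Finset.prod_eq_single i (fun l _ hl => by rw [Pi.single_eq_of_ne hl, fourier_eval_zero])
    (fun h => absurd (Finset.mem_univ i) h), Pi.single_eq_same, fourier_half]

/-- **Half-shifts kill the odd classes**: if `U(x + ½e_i + ½e_{i'}) = U(x)` a.e. then `Û(k) = 0` whenever
`k_i + k_{i'}` is odd (`𝓕(U ∘ τ_h)(k) = e_k(h) Û(k)` and `e_k(½e_i + ½e_{i'}) = (−1)^{k_i + k_{i'}}`). [folklore] -/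
theorem fc_eq_zero_of_halfShift (U : 𝐋) {i i' : Fin 3}
    (h : (fun x => (U : UnitAddTorus (Fin 3) → EuclideanSpace ℝ (Fin 3)) (x + (Pi.single i (((1/2 : ℝ)) : UnitAddCircle) + Pi.single i' (((1/2 : ℝ)) : UnitAddCircle)))) =ᵐ[volume] (U : UnitAddTorus (Fin 3) → EuclideanSpace ℝ (Fin 3)))
    {k : Fin 3 → ℤ} (hk : Odd (k i + k i')) : fc U k = 0 := by
  set u : UnitAddTorus (Fin 3) → EuclideanSpace ℝ (Fin 3) := ⇑U with hu
  have h1 : mFourierCoeff (EuclideanSpace.complexify ∘ fun x => u (x + (Pi.single i (((1/2 : ℝ)) : UnitAddCircle) + Pi.single i' (((1/2 : ℝ)) : UnitAddCircle)))) k = fc U k :=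
    mFourierCoeff_congr_ae (h.fun_comp EuclideanSpace.complexify) k
  have hchar : mFourier k ((Pi.single i (((1/2 : ℝ)) : UnitAddCircle) + Pi.single i' (((1/2 : ℝ)) : UnitAddCircle) : UnitAddTorus (Fin 3))) = -1 := by
    rw [mFourier_apply_add, mFourier_single_half, mFourier_single_half, ← zpow_add₀ (by norm_num : (-1 : ℂ) ≠ 0),
      hk.neg_one_zpow]
  have h2 := mFourierCoeff_comp_add_right (EuclideanSpace.complexify ∘ u)
    ((Pi.single i (((1/2 : ℝ)) : UnitAddCircle) + Pi.single i' (((1/2 : ℝ)) : UnitAddCircle) : UnitAddTorus (Fin 3))) k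
  rw [hchar] at h2
  have h4 : fc U k = (-1 : ℂ) • fc U k := h1.symm.trans h2
  have h5 : (2 : ℂ) • fc U k = 0 := by
    rw [two_smul]
    nth_rewrite 2 [h4]
    rw [neg_one_smul, add_neg_cancel]
  exact (smul_eq_zero.1 h5).resolve_left two_ne_zero

/-- The coordinate mirror `R_i = diag(1, …, −1 (slot i), …, 1)` as an integer matrix. [folklore] -/
def mirrorMat (i : Fin 3) : Matrix (Fin 3) (Fin 3) ℤ := Matrix.diagonal fun l => if l = i then -1 else 1

/-- `R_i² = 1`. [folklore] -/
theorem mirrorMat_mul_self (i : Fin 3) : mirrorMat i * mirrorMat i = 1 := by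
  rw [mirrorMat, Matrix.diagonal_mul_diagonal, ← Matrix.diagonal_one]
  congr 1
  funext l
  split_ifs <;> simp

/-- `R_i` acts on the torus by `x ↦ update x i (−x_i)`. [folklore] -/
theorem mulVecT_mirrorMat (i : Fin 3) (x : UnitAddTorus (Fin 3)) :
    mulVecT (mirrorMat i) x = Function.update x i (-x i) := by
  funext l
  rw [mulVecT_apply]
  simp only [mirrorMat, Matrix.diagonal_apply, ite_smul, zero_smul, Finset.sum_ite_eq, Finset.mem_univ, if_true]
  rcases eq_or_ne l i with rfl | hl
  · simp
  · simp [hl]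

/-- The dual action on frequencies: `k R_i = update k i (−k_i)`. [folklore] -/
theorem vecMul_mirrorMat (k : Fin 3 → ℤ) (i : Fin 3) :
    Matrix.vecMul k (mirrorMat i) = Function.update k i (-k i) := by
  funext l
  rw [mirrorMat, Matrix.vecMul_diagonal]
  rcases eq_or_ne l i with rfl | hl
  · simp
  · simp [hl]

/-- **Mirrors on the Fourier side**: if `U(R_i x)_j = ∓U(x)_j` a.e. (`R_i x = update x i (−x_i)`, sign `−` iff
`j = i`) then `Û(R_i k)_j = ∓Û(k)_j` (substitute `x = R_i y`; `R_i` is a lattice automorphism). [folklore] -/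
theorem fc_update_neg_apply (U : 𝐋) {i j : Fin 3}
    (h : (fun x => (U : UnitAddTorus (Fin 3) → EuclideanSpace ℝ (Fin 3)) (Function.update x i (-x i)) j) =ᵐ[volume]
      (fun x => if j = i then -((U : UnitAddTorus (Fin 3) → EuclideanSpace ℝ (Fin 3)) x j) else (U : UnitAddTorus (Fin 3) → EuclideanSpace ℝ (Fin 3)) x j))
    (k : Fin 3 → ℤ) :
    fc U (Function.update k i (-k i)) j = (if j = i then -1 else 1) * fc U k j := by
  set u : UnitAddTorus (Fin 3) → EuclideanSpace ℝ (Fin 3) := ⇑U with hu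
  set g : UnitAddTorus (Fin 3) → ℂ := fun x => ((u x j : ℝ) : ℂ) with hg
  have hR : (fun x : UnitAddTorus (Fin 3) => Function.update x i (-x i)) = mulVecT (mirrorMat i) := by
    funext x
    exact (mulVecT_mirrorMat i x).symm
  have h1 : mFourierCoeff (g ∘ mulVecT (mirrorMat i)) k = fc U (Function.update k i (-k i)) j := by
    rw [mFourierCoeff_comp_mulVecT (mirrorMat_mul_self i) g k, vecMul_mirrorMat, fc_apply]
  have h2 : mFourierCoeff (g ∘ mulVecT (mirrorMat i)) k =
      mFourierCoeff (fun x => (((if j = i then -(u x j) else u x j : ℝ)) : ℂ)) k := by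
    refine mFourierCoeff_congr_ae ?_ k
    rw [← hR]
    filter_upwards [h] with x hx
    show ((u (Function.update x i (-x i)) j : ℝ) : ℂ) = _
    rw [show u (Function.update x i (-x i)) j = (if j = i then -(u x j) else u x j) from hx]
  have h3 : mFourierCoeff (fun x => (((if j = i then -(u x j) else u x j : ℝ)) : ℂ)) k = (if j = i then -1 else 1) * fc U k j := by
    rcases eq_or_ne j i with rfl | hji
    · simp only [ite_true]
      rw [fc_apply, neg_one_mul, ← mFourierCoeff_neg]
      congr 1
      funext x
      simp [hu]
    · simp only [if_neg hji]
      rw [one_mul, fc_apply]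
  rw [← h1, h2, h3]

/-- The quarter-turn matrix `P : x ↦ (−x₁, x₀, x₂)` of `T³` (integer, determinant `1`). [folklore] -/
def qtMat : Matrix (Fin 3) (Fin 3) ℤ := !![0, -1, 0; 1, 0, 0; 0, 0, 1]

/-- Its inverse `P⁻¹ : y ↦ (y₁, −y₀, y₂)`. [folklore] -/
def qtInv : Matrix (Fin 3) (Fin 3) ℤ := !![0, 1, 0; -1, 0, 0; 0, 0, 1]

/-- `P⁻¹ P = 1`. [folklore] -/
theorem qtInv_mul_qtMat : qtInv * qtMat = 1 := by
  ext a b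
  fin_cases a <;> fin_cases b <;> simp [qtMat, qtInv, Matrix.mul_apply, Fin.sum_univ_three]

/-- The route's quarter-turn `x ↦ (½ − x₁, x₀, x₂)` is `x ↦ P x + ½ e₀`. [folklore] -/
theorem quarterTurn_eq (x : UnitAddTorus (Fin 3)) :
    (![(((1/2 : ℝ)) : UnitAddCircle) - x 1, x 0, x 2] : UnitAddTorus (Fin 3)) =
      mulVecT qtMat x + Pi.single (0 : Fin 3) (((1/2 : ℝ)) : UnitAddCircle) := by
  funext l
  fin_cases l
  · simp [mulVecT_apply, qtMat, Fin.sum_univ_three, sub_eq_neg_add]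
  · simp [mulVecT_apply, qtMat, Fin.sum_univ_three]
  · simp [mulVecT_apply, qtMat, Fin.sum_univ_three]

/-- The dual action on frequencies: `k P⁻¹ = (−k₁, k₀, k₂)`. [folklore] -/
theorem vecMul_qtInv (k : Fin 3 → ℤ) : Matrix.vecMul k qtInv = ![-(k 1), k 0, k 2] := by
  funext l
  fin_cases l <;> simp [Matrix.vecMul, dotProduct, qtInv, Fin.sum_univ_three]

/-- **The quarter-turn on the Fourier side**: if `U(½ − x₁, x₀, x₂) = (−U₁, U₀, U₂)(x)` a.e. then, for every
`k`, `e_{−k₁}(½) Û(−k₁, k₀, k₂) = (−Û(k)₁, Û(k)₀, Û(k)₂)` componentwise. [folklore] -/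
theorem fc_quarterTurn (U : 𝐋)
    (h : (fun x => (U : UnitAddTorus (Fin 3) → EuclideanSpace ℝ (Fin 3)) ![(((1/2 : ℝ)) : UnitAddCircle) - x 1, x 0, x 2]) =ᵐ[volume]
      (fun x => !₂[-((U : UnitAddTorus (Fin 3) → EuclideanSpace ℝ (Fin 3)) x 1), (U : UnitAddTorus (Fin 3) → EuclideanSpace ℝ (Fin 3)) x 0, (U : UnitAddTorus (Fin 3) → EuclideanSpace ℝ (Fin 3)) x 2]))
    (k : Fin 3 → ℤ) :
    (fourier (-(k 1)) (((1/2 : ℝ)) : UnitAddCircle) : ℂ) * fc U ![-(k 1), k 0, k 2] 0 = -(fc U k 1) ∧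
    (fourier (-(k 1)) (((1/2 : ℝ)) : UnitAddCircle) : ℂ) * fc U ![-(k 1), k 0, k 2] 1 = fc U k 0 ∧
    (fourier (-(k 1)) (((1/2 : ℝ)) : UnitAddCircle) : ℂ) * fc U ![-(k 1), k 0, k 2] 2 = fc U k 2 := by
  set u : UnitAddTorus (Fin 3) → EuclideanSpace ℝ (Fin 3) := ⇑U with hu
  have key : ∀ j : Fin 3, (fourier (-(k 1)) (((1/2 : ℝ)) : UnitAddCircle) : ℂ) * fc U ![-(k 1), k 0, k 2] j =
      mFourierCoeff (fun x => (((!₂[-(u x 1), u x 0, u x 2] : EuclideanSpace ℝ (Fin 3)) j : ℝ) : ℂ)) k := by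
    intro j
    set g : UnitAddTorus (Fin 3) → ℂ := fun x => ((u x j : ℝ) : ℂ) with hg
    have e : (fun x : UnitAddTorus (Fin 3) => g (![(((1/2 : ℝ)) : UnitAddCircle) - x 1, x 0, x 2])) =
        (fun y => g (y + Pi.single (0 : Fin 3) (((1/2 : ℝ)) : UnitAddCircle))) ∘ mulVecT qtMat := by
      funext x; simp only [Function.comp_apply, quarterTurn_eq]
    have h1 : mFourierCoeff (fun x : UnitAddTorus (Fin 3) => g (![(((1/2 : ℝ)) : UnitAddCircle) - x 1, x 0, x 2])) k =
        (fourier (-(k 1)) (((1/2 : ℝ)) : UnitAddCircle) : ℂ) * fc U ![-(k 1), k 0, k 2] j := by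
      rw [e, mFourierCoeff_comp_mulVecT qtInv_mul_qtMat, mFourierCoeff_comp_add_single, vecMul_qtInv, fc_apply]
      simp [hg, hu]
    have h2 : mFourierCoeff (fun x : UnitAddTorus (Fin 3) => g (![(((1/2 : ℝ)) : UnitAddCircle) - x 1, x 0, x 2])) k =
        mFourierCoeff (fun x => (((!₂[-(u x 1), u x 0, u x 2] : EuclideanSpace ℝ (Fin 3)) j : ℝ) : ℂ)) k := by
      refine mFourierCoeff_congr_ae ?_ k
      filter_upwards [h] with x hx
      show ((u ![(((1/2 : ℝ)) : UnitAddCircle) - x 1, x 0, x 2] j : ℝ) : ℂ) = _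
      rw [show u ![(((1/2 : ℝ)) : UnitAddCircle) - x 1, x 0, x 2] = !₂[-(u x 1), u x 0, u x 2] from hx]
    rw [← h1, h2]
  refine ⟨?_, ?_, ?_⟩
  · rw [key 0, fc_apply, ← mFourierCoeff_neg]
    congr 1
    funext x
    simp [hu]
  · rw [key 1, fc_apply]
    rfl
  · rw [key 2, fc_apply]
    rfl

/-! ### §2 Parity bookkeeping on the lattice `ℤ³` -/

/-- An odd integer has square `1` or at least `9`. [folklore] -/
theorem sq_eq_one_or_nine_le_of_odd {z : ℤ} (hz : Odd z) : z ^ 2 = 1 ∨ 9 ≤ z ^ 2 := by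
  obtain ⟨m, rfl⟩ := hz
  rcases le_or_gt 1 m with hm | hm
  · right; nlinarith
  · rcases le_or_gt m (-2) with hm' | hm'
    · right; nlinarith
    · left
      have : m = 0 ∨ m = -1 := by omega
      rcases this with rfl | rfl <;> norm_num

/-- A non-zero even integer has square at least `4`. [folklore] -/
theorem four_le_sq_of_even {z : ℤ} (hz : Even z) (hz0 : z ≠ 0) : 4 ≤ z ^ 2 := by
  obtain ⟨m, rfl⟩ := hz
  have hm : m ≠ 0 := by
    rintro rfl
    exact hz0 (by simp)
  have h1 : 1 ≤ m ^ 2 := (one_le_sq_iff_one_le_abs m).2 (Int.one_le_abs hm)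
  nlinarith

/-- Membership in the Taylor–Green shell `{±1}³`, coordinatewise. [folklore] -/
theorem mem_tgShell_iff (k : Fin 3 → ℤ) : k ∈ tgShell ↔ ∀ j, k j = 1 ∨ k j = -1 := by
  simp [tgShell, Fintype.mem_piFinset]

/-- `|k|²` on `ℤ³`, as a cast integer. [folklore] -/
theorem freqNormSq_fin3 (k : Fin 3 → ℤ) : freqNormSq k = ((k 0 ^ 2 + k 1 ^ 2 + k 2 ^ 2 : ℤ) : ℝ) := by
  rw [freqNormSq, Fin.sum_univ_three]
  push_cast
  ring

/-- **Lattice trichotomy behind `λ = 32π²` on the symmetric class**: if `k₀ ≡ k₁ ≡ k₂ (mod 2)` then either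
`k ∈ {±1}³`, or `|k|² ≥ 8`, or `k` has at most one non-zero coordinate. [folklore] -/
theorem tgShell_or_eight_le_or_axis (k : Fin 3 → ℤ) (h01 : Even (k 0 + k 1)) (h02 : Even (k 0 + k 2)) :
    k ∈ tgShell ∨ (8 : ℤ) ≤ k 0 ^ 2 + k 1 ^ 2 + k 2 ^ 2 ∨ ∃ i : Fin 3, ∀ l, l ≠ i → k l = 0 := by
  have s0 := sq_nonneg (k 0)
  have s1 := sq_nonneg (k 1)
  have s2 := sq_nonneg (k 2)
  rcases Int.even_or_odd (k 0) with h0 | h0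
  · -- all coordinates even
    have h1 : Even (k 1) := (Int.even_add.1 h01).1 h0
    have h2 : Even (k 2) := (Int.even_add.1 h02).1 h0
    by_cases hA : (k 0 ≠ 0 ∧ k 1 ≠ 0) ∨ (k 0 ≠ 0 ∧ k 2 ≠ 0) ∨ (k 1 ≠ 0 ∧ k 2 ≠ 0)
    · right; left
      rcases hA with ⟨ha, hb⟩ | ⟨ha, hb⟩ | ⟨ha, hb⟩
      · have := four_le_sq_of_even h0 ha
        have := four_le_sq_of_even h1 hb
        omega
      · have := four_le_sq_of_even h0 ha
        have := four_le_sq_of_even h2 hb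
        omega
      · have := four_le_sq_of_even h1 ha
        have := four_le_sq_of_even h2 hb
        omega
    · right; right
      push Not at hA
      obtain ⟨hA1, hA2, hA3⟩ := hA
      by_cases hk0 : k 0 = 0
      · by_cases hk1 : k 1 = 0
        · exact ⟨2, fun l hl => by fin_cases l; exacts [hk0, hk1, absurd rfl hl]⟩
        · exact ⟨1, fun l hl => by fin_cases l; exacts [hk0, absurd rfl hl, hA3 hk1]⟩
      · exact ⟨0, fun l hl => by fin_cases l; exacts [absurd rfl hl, hA1 hk0, hA2 hk0]⟩
  · -- all coordinates odd
    have h1 : Odd (k 1) := Int.not_even_iff_odd.1 fun h => Int.not_even_iff_odd.2 h0 ((Int.even_add.1 h01).2 h)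
    have h2 : Odd (k 2) := Int.not_even_iff_odd.1 fun h => Int.not_even_iff_odd.2 h0 ((Int.even_add.1 h02).2 h)
    rcases sq_eq_one_or_nine_le_of_odd h0 with e0 | e0
    · rcases sq_eq_one_or_nine_le_of_odd h1 with e1 | e1
      · rcases sq_eq_one_or_nine_le_of_odd h2 with e2 | e2
        · left
          rw [mem_tgShell_iff]
          intro j
          fin_cases j
          · exact sq_eq_one_iff.1 e0
          · exact sq_eq_one_iff.1 e1
          · exact sq_eq_one_iff.1 e2
        · right; left; omega
      · right; left; omega
    · right; left; omega

/-- Slim variant: if `k₀ ≡ k₁ ≡ k₂ (mod 2)` and `k ≠ 0` then `|k|² ≥ 3`. [folklore] -/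
theorem three_le_of_parity (k : Fin 3 → ℤ) (h01 : Even (k 0 + k 1)) (h02 : Even (k 0 + k 2)) (hk : k ≠ 0) :
    (3 : ℤ) ≤ k 0 ^ 2 + k 1 ^ 2 + k 2 ^ 2 := by
  have s0 := sq_nonneg (k 0)
  have s1 := sq_nonneg (k 1)
  have s2 := sq_nonneg (k 2)
  rcases Int.even_or_odd (k 0) with h0 | h0
  · have h1 : Even (k 1) := (Int.even_add.1 h01).1 h0
    have h2 : Even (k 2) := (Int.even_add.1 h02).1 h0
    by_cases hk0 : k 0 = 0
    · by_cases hk1 : k 1 = 0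
      · by_cases hk2 : k 2 = 0
        · exact absurd (funext fun j => by fin_cases j <;> simp only [Pi.zero_apply] <;> assumption) hk
        · have := four_le_sq_of_even h2 hk2
          omega
      · have := four_le_sq_of_even h1 hk1
        omega
    · have := four_le_sq_of_even h0 hk0
      omega
  · have h1 : Odd (k 1) := Int.not_even_iff_odd.1 fun h => Int.not_even_iff_odd.2 h0 ((Int.even_add.1 h01).2 h)
    have h2 : Odd (k 2) := Int.not_even_iff_odd.1 fun h => Int.not_even_iff_odd.2 h0 ((Int.even_add.1 h02).2 h)
    have o0 := sq_eq_one_or_nine_le_of_odd h0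
    have o1 := sq_eq_one_or_nine_le_of_odd h1
    have o2 := sq_eq_one_or_nine_le_of_odd h2
    omega

end Summit.AnomalousDissipation.AnomalousDissipation.Theorems.DegreeGate

end
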